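import Literature.NumberTheory.Rogawski1990.LocalTransferTransport       -- ★ `OrbitalMeasureFamily.transport ψ`, `transportEquiv`, `transportConj`, `preClass`, `transportOrbitEquiv`
import Literature.NumberTheory.Rogawski1990.TransferFactsCanonical        -- ★ `OrbitalMeasureFamily.IsQuotientOf`
import Literature.NumberTheory.Automorphic.CompactCoreLevelPoint          -- ★ `map_mulAutConj_eq_self` (a two-sided Haar measure is conjugation invariant)
import HarnessLib

/-!
# `IsQuotientOf` is transported along a bicontinuous group isomorphism: `ψ_* (dν′ ∕ dt′) = d(ψ_* ν′) ∕ d(ψ_* t′)`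

Topic `NumberTheory/Rogawski1990`; namespace `Literature.NumberTheory.Automorphic` (the namespace of ★ `OrbitalMeasureFamily.IsQuotientOf` and of ★
`OrbitalMeasureFamily.transport`).  THEOREMS ONLY (no definition, no instance, no notation, no named fact, no `sorry`).  Cell `hodgecm-mathlib`, F0∕P3a
ROAD-Sd (books row #111 `ArchCentralValueTransferExistsClosed`), item (T-d)(b) of the LEAD desk (F0P3a-plan (g8) T7-16 (D); F0P3-p03 (g8)) = item (c)(W′)
of the §3′ memo `ROAD-Sd-3prime-congruence` («`IsQuotientOf` is transported by a bicontinuous iso»); the two-group twin of ★ `OrbitalMeasureQuotientOfPoint` §1.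

THE STATEMENT ([Rogawski1990, §1.7 p. 6 («compatible measures»), §4.3 (4.3.1) p. 43]; [DeitmarEchterhoff2014, Thm. 1.5.3]; [Gelbart1975, §10 pp. 154–155]).
Let `ψ : B ≃* A` be a bicontinuous isomorphism of locally compact second countable Hausdorff groups, `ν′` a two-sided Haar measure on `B` and `ν = ψ_* ν′`
(again two-sided Haar), and let the orbital measure family `m′` on `B` be, on the `P′`-classes, THE QUOTIENT FAMILY of `ν′` by given centraliser measures
`t′` (★ `m′.IsQuotientOf P′ ν′ t′`: `m′ c′ = dν′ ∕ dt′_{out c′}`).  The TRANSPORTED family `ψ_* m′` (★ `OrbitalMeasureFamily.transport`: on the class `c` of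
`A`, the push-forward of `m′(ψ⁻¹ c)` along `y ↦ x_c⁻¹ · e_c(y)`, `e_c = conj(x_c) ∘ ψ` the isomorphism taking `out (ψ⁻¹ c)` to `out c`) is then, on every
class `c` with `P′ (out (ψ⁻¹ c))`, the quotient of `ν` by the TRANSPORTED centraliser measure `(e_c|_{Z})_* t′_{out (ψ⁻¹ c)}` on `Z(out c)`
(`OrbitalMeasureFamily.IsQuotientOf.transport_apply`; ★ `map_cosetCongr_quotientMeasure` — the quotient measure is natural — then ★ `map_smul_quotientMeasure`
for the left translation and ★ `map_mulAutConj_eq_self` for `(e_c)_* ν′ = conj(x_c)_* ν = ν`); hence `ψ_* m′` IS `IsQuotientOf P ν t` for every predicate `P`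
with `P (out c) → P′ (out (ψ⁻¹ c))` and every centraliser datum `t` agreeing with the transported one at the representatives
(`OrbitalMeasureFamily.IsQuotientOf.transport`) — «the orbital integrals are defined using compatible measures»: compatibility IS transport, and this is
its bookkeeping across an isomorphism of groups (for the archimedean congruence iso ★ `ArchCongruenceTransport` of ROAD-Sd (T-d)).
The Haar book-keeping for `ν = ψ_* ν′` is ★ already (Mathlib `MulEquiv.isHaarMeasure_map`; ★ `isMulRightInvariant_map_mulEquiv_of_isMulRightInvariant` in
`Automorphic/UnitaryGroupOrbitalMeasureOfLocalQuotient`) and is not restated.  The CANONICAL version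
(`m′.IsCanonical P′ ν′ ⇒ (ψ_* m′).IsCanonical P ν`) is already ★ `OrbitalMeasureFamily.IsCanonical.transport` (`Rogawski1990/LocalTransferTransportCanonical`) and
is NOT restated here; this file is its RELATIVE (Weil-form) twin, where the centraliser measures are a datum.
NOT here: a global CHOICE of `t` coherent off the representatives (needs commutative centralisers), the transfer-factor ∕ norm-pair transport, the
inner- and Δ-transfer relations (memo items (b), (c)(v)(vi)).  HONEST LABEL: generic; HC_CM is proved only modulo the printed citations until rung 0
closes, and this file moves no count.

## References
* [Rogawski1990] J. D. Rogawski, *Automorphic Representations of Unitary Groups in Three Variables* (1990), §1.7 p. 6, §4.3 (4.3.1) p. 43.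
* [DeitmarEchterhoff2014] A. Deitmar, S. Echterhoff, *Principles of Harmonic Analysis*, 2nd ed. (2014), Thm. 1.5.3.
* [Gelbart1975] S. Gelbart, *Automorphic Forms on Adele Groups* (1975), §10 pp. 154–155.
-/

set_option autoImplicit false

noncomputable section

open MeasureTheory Measure Set
open Literature.MeasureTheory.Group Literature.NumberTheory.Rogawski1990

namespace Literature.NumberTheory.Automorphic

/-! ## §1 Transport of `IsQuotientOf` along `ψ : B ≃* A` -/

section Transport

variable {A B : Type*} [Group A] [Group B] [TopologicalSpace A] [TopologicalSpace B]
  [IsTopologicalGroup A] [IsTopologicalGroup B] [LocallyCompactSpace A] [LocallyCompactSpace B]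
  [SecondCountableTopology A] [SecondCountableTopology B] [T2Space A] [T2Space B]
  [MeasurableSpace A] [BorelSpace A] [MeasurableSpace B] [BorelSpace B]
  [∀ a : A, MeasurableSpace (A ⧸ Subgroup.centralizer ({a} : Set A))] [∀ a : A, BorelSpace (A ⧸ Subgroup.centralizer ({a} : Set A))]
  [∀ b : B, MeasurableSpace (B ⧸ Subgroup.centralizer ({b} : Set B))] [∀ b : B, BorelSpace (B ⧸ Subgroup.centralizer ({b} : Set B))]
  (ψ : B ≃* A) (hψ : Continuous ψ) (hψs : Continuous ψ.symm)
  {P' : B → Prop} (ν' : Measure B) [ν'.IsHaarMeasure] [ν'.IsMulRightInvariant]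
  (t' : ∀ b : B, Measure (Subgroup.centralizer ({b} : Set B))) {m' : OrbitalMeasureFamily B}
  (ν : Measure A) [ν.IsHaarMeasure] [ν.IsMulRightInvariant]

omit [∀ a : A, MeasurableSpace (A ⧸ Subgroup.centralizer ({a} : Set A))] [∀ a : A, BorelSpace (A ⧸ Subgroup.centralizer ({a} : Set A))] in
/-- The invariant quotient measure `dν ∕ dρ` depends on the centraliser measure `ρ` only (not on the instance witnesses): equal measures give equal
quotients. [cite: DeitmarEchterhoff2014, Thm. 1.5.3] -/
private theorem quotientMeasure_congr_of_eq' {Z : Subgroup A} (hZ : IsClosed (Z : Set A)) [LocallyCompactSpace Z]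
    [SecondCountableTopology Z] [MeasurableSpace (A ⧸ Z)] [BorelSpace (A ⧸ Z)] (μ : Measure A) [μ.IsHaarMeasure]
    [μ.IsMulRightInvariant] (ρ₁ ρ₂ : Measure Z) [ρ₁.IsHaarMeasure] [ρ₁.IsInvInvariant] [ρ₂.IsHaarMeasure] [ρ₂.IsInvInvariant]
    (hρ : ρ₁ = ρ₂) : quotientMeasure Z ρ₁ hZ μ = quotientMeasure Z ρ₂ hZ μ := by
  subst hρ
  rfl

/-- **One class, explicit datum.**  If `m′ (ψ⁻¹ c) = dν′ ∕ dt_c` for a Haar, inversion-invariant measure `t_c` on `Z(out (ψ⁻¹ c))` and `ν = ψ_* ν′` is two-sided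
Haar, then the transported measure `(e_c|_Z)_* t_c` on `Z(out c)` (`e_c = transportEquiv ψ c = conj(x_c) ∘ ψ`, taking `out (ψ⁻¹ c)` to `out c`) is Haar and
inversion invariant and **`(ψ_* m′) c = dν ∕ d((e_c|_Z)_* t_c)`** (★ `map_cosetCongr_quotientMeasure`, ★ `map_smul_quotientMeasure`, ★ `map_mulAutConj_eq_self`).
[cite: Rogawski1990, §1.7 p. 6; §4.3 (4.3.1) p. 43] [cite: DeitmarEchterhoff2014, Thm. 1.5.3] [cite: Gelbart1975, §10 pp. 154–155] -/
theorem OrbitalMeasureFamily.transport_apply_eq_quotientMeasure_map (m' : OrbitalMeasureFamily B) (hν : ν = Measure.map ψ ν') (c : ConjClasses A)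
    (tc : Measure (Subgroup.centralizer ({(Quotient.out (preClass ψ c) : B)} : Set B))) [tc.IsHaarMeasure] [tc.IsInvInvariant]
    (hmc : m' (preClass ψ c) = quotientMeasure (Subgroup.centralizer ({(Quotient.out (preClass ψ c) : B)} : Set B)) tc
      (isClosed_coe_centralizer_singleton (Quotient.out (preClass ψ c) : B)) ν') :
    ∃ (_ : (Measure.map (subgroupCongrHomeomorph (transportEquiv ψ c)
          (Subgroup.centralizer ({(Quotient.out (preClass ψ c) : B)} : Set B)) (Subgroup.centralizer ({(Quotient.out c : A)} : Set A))
          (forall_apply_mem_centralizer_singleton_iff_of_eq (transportEquiv ψ c) (transportEquiv_out ψ c))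
          (continuous_transportEquiv ψ hψ c) (continuous_transportEquiv_symm ψ hψs c)) tc).IsHaarMeasure)
      (_ : (Measure.map (subgroupCongrHomeomorph (transportEquiv ψ c)
          (Subgroup.centralizer ({(Quotient.out (preClass ψ c) : B)} : Set B)) (Subgroup.centralizer ({(Quotient.out c : A)} : Set A))
          (forall_apply_mem_centralizer_singleton_iff_of_eq (transportEquiv ψ c) (transportEquiv_out ψ c))
          (continuous_transportEquiv ψ hψ c) (continuous_transportEquiv_symm ψ hψs c)) tc).IsInvInvariant),
      (m'.transport ψ hψ hψs) c = quotientMeasure (Subgroup.centralizer ({(Quotient.out c : A)} : Set A))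
        (Measure.map (subgroupCongrHomeomorph (transportEquiv ψ c)
          (Subgroup.centralizer ({(Quotient.out (preClass ψ c) : B)} : Set B)) (Subgroup.centralizer ({(Quotient.out c : A)} : Set A))
          (forall_apply_mem_centralizer_singleton_iff_of_eq (transportEquiv ψ c) (transportEquiv_out ψ c))
          (continuous_transportEquiv ψ hψ c) (continuous_transportEquiv_symm ψ hψs c)) tc)
        (isClosed_coe_centralizer_singleton (Quotient.out c : A)) ν := by
  have he : Continuous (transportEquiv ψ c) := continuous_transportEquiv ψ hψ c
  have hes : Continuous (transportEquiv ψ c).symm := continuous_transportEquiv_symm ψ hψs c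
  haveI hZc : IsClosed ((Subgroup.centralizer ({(Quotient.out (preClass ψ c) : B)} : Set B) : Subgroup B) : Set B) :=
    isClosed_coe_centralizer_singleton _
  haveI hZ'c : IsClosed ((Subgroup.centralizer ({(Quotient.out c : A)} : Set A) : Subgroup A) : Set A) :=
    isClosed_coe_centralizer_singleton _
  haveI : LocallyCompactSpace (Subgroup.centralizer ({(Quotient.out (preClass ψ c) : B)} : Set B)) :=
    hZc.isClosedEmbedding_subtypeVal.locallyCompactSpace
  haveI : SecondCountableTopology (Subgroup.centralizer ({(Quotient.out (preClass ψ c) : B)} : Set B)) :=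
    TopologicalSpace.Subtype.secondCountableTopology _
  haveI : LocallyCompactSpace (Subgroup.centralizer ({(Quotient.out c : A)} : Set A)) :=
    hZ'c.isClosedEmbedding_subtypeVal.locallyCompactSpace
  haveI : SecondCountableTopology (Subgroup.centralizer ({(Quotient.out c : A)} : Set A)) :=
    TopologicalSpace.Subtype.secondCountableTopology _
  -- the restriction `Z(out (ψ⁻¹ c)) ≃ Z(out c)` of `e_c`, as a homeomorphism and as a continuous multiplicative equivalence
  let eH : Subgroup.centralizer ({(Quotient.out (preClass ψ c) : B)} : Set B) ≃ₜ Subgroup.centralizer ({(Quotient.out c : A)} : Set A) :=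
    subgroupCongrHomeomorph (transportEquiv ψ c) _ _
      (forall_apply_mem_centralizer_singleton_iff_of_eq (transportEquiv ψ c) (transportEquiv_out ψ c)) he hes
  let eZ : Subgroup.centralizer ({(Quotient.out (preClass ψ c) : B)} : Set B) ≃ₜ* Subgroup.centralizer ({(Quotient.out c : A)} : Set A) :=
    { toMulEquiv :=
        { toEquiv := eH.toEquiv
          map_mul' := fun a b => Subtype.ext (map_mul (transportEquiv ψ c) (a : B) (b : B)) }
      continuous_toFun := eH.continuous
      continuous_invFun := eH.symm.continuous }
  haveI ht'1 : (Measure.map eH tc).IsHaarMeasure := MulEquiv.isHaarMeasure_map tc eZ.toMulEquiv eZ.continuous eZ.symm.continuous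
  haveI ht'2 : (Measure.map eH tc).IsInvInvariant := isInvInvariant_map_mulEquiv eZ.toMulEquiv eZ.continuous.measurable tc
  refine ⟨ht'1, ht'2, ?_⟩
  -- `(e_c)_* ν′ = conj(x_c)_* (ψ_* ν′) = ν`
  have hνe : ν = Measure.map (transportEquiv ψ c) ν' := by
    have hcomp : ((transportEquiv ψ c : B ≃* A) : B → A) = (MulAut.conj (transportConj ψ c) : A ≃* A) ∘ (ψ : B → A) := rfl
    rw [hcomp, ← Measure.map_map (continuous_mulAutConj (transportConj ψ c)).measurable hψ.measurable, ← hν,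
      map_mulAutConj_eq_self ν (transportConj ψ c)]
  have hmap := map_cosetCongr_quotientMeasure (transportEquiv ψ c) he hes _ _
    (forall_apply_mem_centralizer_singleton_iff_of_eq (transportEquiv ψ c) (transportEquiv_out ψ c)) tc (Measure.map eH tc) ν' ν rfl hνe
  -- unfold the transport: push forward along `cosetCongr e_c`, then along the left translation `x_c⁻¹`
  change Measure.map (transportOrbitEquiv ψ hψ hψs c) (m' (preClass ψ c)) = _
  rw [hmc, transportOrbitEquiv, MeasurableEquiv.coe_trans,
    ← Measure.map_map (MeasurableEquiv.measurable _) (MeasurableEquiv.measurable _), coe_cosetCongrMeasurableEquiv, hmap]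
  exact map_smul_quotientMeasure _ _ _ ν ((transportConj ψ c)⁻¹)

/-- **`IsQuotientOf` transported, class by class.**  For `m′.IsQuotientOf P′ ν′ t′`, `ν = ψ_* ν′` two-sided Haar, and a class `c` of `A` with
`P′ (out (ψ⁻¹ c))`: the transported centraliser measure `(e_c|_Z)_* t′_{out (ψ⁻¹ c)}` on `Z(out c)` is Haar and inversion invariant, and
**`(ψ_* m′) c = dν ∕ d((e_c|_Z)_* t′)`**. [cite: Rogawski1990, §1.7 p. 6; §4.3 (4.3.1) p. 43] [cite: DeitmarEchterhoff2014, Thm. 1.5.3] [cite: Gelbart1975, §10 pp. 154–155] -/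
theorem OrbitalMeasureFamily.IsQuotientOf.transport_apply (h : m'.IsQuotientOf P' ν' t') (hν : ν = Measure.map ψ ν')
    (c : ConjClasses A) (hc : P' (Quotient.out (preClass ψ c))) :
    ∃ (_ : (Measure.map (subgroupCongrHomeomorph (transportEquiv ψ c)
          (Subgroup.centralizer ({(Quotient.out (preClass ψ c) : B)} : Set B)) (Subgroup.centralizer ({(Quotient.out c : A)} : Set A))
          (forall_apply_mem_centralizer_singleton_iff_of_eq (transportEquiv ψ c) (transportEquiv_out ψ c))
          (continuous_transportEquiv ψ hψ c) (continuous_transportEquiv_symm ψ hψs c))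
        (t' (Quotient.out (preClass ψ c)))).IsHaarMeasure)
      (_ : (Measure.map (subgroupCongrHomeomorph (transportEquiv ψ c)
          (Subgroup.centralizer ({(Quotient.out (preClass ψ c) : B)} : Set B)) (Subgroup.centralizer ({(Quotient.out c : A)} : Set A))
          (forall_apply_mem_centralizer_singleton_iff_of_eq (transportEquiv ψ c) (transportEquiv_out ψ c))
          (continuous_transportEquiv ψ hψ c) (continuous_transportEquiv_symm ψ hψs c))
        (t' (Quotient.out (preClass ψ c)))).IsInvInvariant),
      (m'.transport ψ hψ hψs) c = quotientMeasure (Subgroup.centralizer ({(Quotient.out c : A)} : Set A))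
        (Measure.map (subgroupCongrHomeomorph (transportEquiv ψ c)
          (Subgroup.centralizer ({(Quotient.out (preClass ψ c) : B)} : Set B)) (Subgroup.centralizer ({(Quotient.out c : A)} : Set A))
          (forall_apply_mem_centralizer_singleton_iff_of_eq (transportEquiv ψ c) (transportEquiv_out ψ c))
          (continuous_transportEquiv ψ hψ c) (continuous_transportEquiv_symm ψ hψs c))
          (t' (Quotient.out (preClass ψ c))))
        (isClosed_coe_centralizer_singleton (Quotient.out c : A)) ν := by
  obtain ⟨ht, hti, hmc⟩ := h _ hc
  exact OrbitalMeasureFamily.transport_apply_eq_quotientMeasure_map ψ hψ hψs ν' ν m' hν c (t' (Quotient.out (preClass ψ c))) hmc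

/-- **`IsQuotientOf` IS TRANSPORTED ALONG A BICONTINUOUS ISOMORPHISM** (the Weil form of the orbital measures is stable under «compatible» transport):
if `m′.IsQuotientOf P′ ν′ t′`, `ν = ψ_* ν′`, `P (out c) → P′ (out (ψ⁻¹ c))` for every class `c` of `A`, and the centraliser datum `t` on `A` agrees AT THE
REPRESENTATIVES with the transported one (`t (out c) = (e_c|_Z)_* t′_{out (ψ⁻¹ c)}` whenever `P (out c)` — `t` is read nowhere else), then
`(ψ_* m′).IsQuotientOf P ν t`. [cite: Rogawski1990, §1.7 p. 6; §4.3 (4.3.1) p. 43] [cite: DeitmarEchterhoff2014, Thm. 1.5.3] -/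
theorem OrbitalMeasureFamily.IsQuotientOf.transport (h : m'.IsQuotientOf P' ν' t') (hν : ν = Measure.map ψ ν')
    {P : A → Prop} (hPP' : ∀ c : ConjClasses A, P (Quotient.out c) → P' (Quotient.out (preClass ψ c)))
    (t : ∀ a : A, Measure (Subgroup.centralizer ({a} : Set A)))
    (ht : ∀ c : ConjClasses A, P (Quotient.out c) →
      t (Quotient.out c) = Measure.map (subgroupCongrHomeomorph (transportEquiv ψ c)
          (Subgroup.centralizer ({(Quotient.out (preClass ψ c) : B)} : Set B)) (Subgroup.centralizer ({(Quotient.out c : A)} : Set A))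
          (forall_apply_mem_centralizer_singleton_iff_of_eq (transportEquiv ψ c) (transportEquiv_out ψ c))
          (continuous_transportEquiv ψ hψ c) (continuous_transportEquiv_symm ψ hψs c))
        (t' (Quotient.out (preClass ψ c)))) :
    (m'.transport ψ hψ hψs).IsQuotientOf P ν t := by
  intro c hc
  obtain ⟨h1, h2, h3⟩ := h.transport_apply ψ hψ hψs ν' t' ν hν c (hPP' c hc)
  have heq := ht c hc
  haveI i1 : (t (Quotient.out c)).IsHaarMeasure := by rw [heq]; exact h1
  haveI i2 : (t (Quotient.out c)).IsInvInvariant := by rw [heq]; exact h2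
  haveI : IsClosed ((Subgroup.centralizer ({(Quotient.out c : A)} : Set A) : Subgroup A) : Set A) :=
    isClosed_coe_centralizer_singleton _
  haveI : LocallyCompactSpace (Subgroup.centralizer ({(Quotient.out c : A)} : Set A)) :=
    (isClosed_coe_centralizer_singleton (Quotient.out c : A)).isClosedEmbedding_subtypeVal.locallyCompactSpace
  haveI : SecondCountableTopology (Subgroup.centralizer ({(Quotient.out c : A)} : Set A)) :=
    TopologicalSpace.Subtype.secondCountableTopology _
  refine ⟨i1, i2, ?_⟩
  rw [h3]
  exact quotientMeasure_congr_of_eq' _ ν _ _ heq.symm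


end Transport

end Literature.NumberTheory.Automorphic

end
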